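import Summits.Ventures.HSemireg.WedgeHankelRecurrenceGaussChebyshevMixedResultantTwo
import Summits.Ventures.HSemireg.WedgeHankelRecurrenceGaussChebyshevExample
import Summits.Ventures.HSemireg.WedgeHankelRecurrenceGaussChebyshevUExample

/-!
# Venture HSemireg — **TRACE, SECOND NEWTON SUM AND DETERMINANT OF THE CHEBYSHEV JACOBI MATRICES AS TRIGONOMETRIC IDENTITIES**: for the Gauss–Chebyshev nodes of the first kind
# (`x_k = cos((2k+1)π∕(2n))`, `n = t+1`) and of the second kind (`y_j = cos(jπ∕(n+1))`): **`Σ x_k = Σ y_j = 0`**, **`Σ_{k<m+2} x_k² = (m+2)∕2`**, **`Σ_{j≤m+1} y_j² = (m+1)∕2`**,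
# **`∏_k x_k = (−1)^{t+1} 2^{−t} T_{t+1}(0)`**, **`∏_j y_j = (−1)^{t+1} 2^{−(t+1)} U_{t+1}(0)`** (so both products vanish exactly for an odd number of nodes)

HONEST FRAMING. Part of the Lean index of the computation cell `pub-hsemireg` (seat p10 gen 47, Sunday typer «UNIFORM-IN-n»).  Real finite sums ∕ products and `Real.cos` only; no variety, no
cohomology theory, no sheaf, no Ext group and no semiregularity map is constructed here; nothing here says that HC / HC_CM / HC_AV holds; no Literature fact (unproved `Prop`) is declared or used.
Custodian versions as in `WedgeHankelSiegelIdeal` (1/3).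
SOURCES (cited).  T. S. Chihara, *An Introduction to Orthogonal Polynomials* (1978), Ch. I (4.13)–(4.14) (Newton sums of the zeros from the recurrence coefficients); G. H. Golub, J. H. Welsch, Math.
Comp. 23 (1969) 221–230 (trace ∕ determinant of the Jacobi matrix); G. Szegő, *Orthogonal Polynomials*, (1.12.3), (6.3.5).  The trigonometric identities are COROLLARIES typed here of §1063.
PROOF TYPED HERE.  §1063 `sum_recurrence_zeros`, `sum_recurrence_zeros_sq` with the Chebyshev recurrences of §1097 ∕ §1125 (`chebyshev_recurrence_eq_prod`, `chebyshev_recurrence_eq_T`,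
`chebyshevU_recurrence_eq_prod`, `chebyshevU_recurrence_eq_U`, built by `recurrence_of_coefficients`); the products by evaluating `q_{t+1} = ∏(X − x_k) = 2^{−t} T_{t+1}` at `0` (`Finset.prod_neg`).
DEDUP DISCLOSURE (`rg -n -i 'nodes_sum|nodes_sq_sum|nodes_prod' Summits/Ventures/HSemireg`, 2026-09-04): §11xx `gegenbauer_zeros_sq_sum`, `legendre_zeros_sq_sum`, `laguerre_zeros_sq_sum` (other
families); 0 hits for the 6 names below.

WHAT IS IN THE TREE.  §1063 `sum_recurrence_zeros`, `sum_recurrence_zeros_sq`; §1097 ∕ §1125 Chebyshev recurrence facts; Mathlib `Finset.prod_neg`, `T_eval_zero_of_odd`, `U_eval_zero_of_odd`.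
THIS FILE (namespace `Summit.Ventures.HSemireg.Wedge.HankelOuter` continued; CHAINED on N440 (import) plus the two Chebyshev example leaves; 0 definitions):
* §1206 `chebyshev_nodes_sum`, `chebyshevU_nodes_sum` (`= 0`), **`chebyshev_nodes_sq_sum`** (`= (m+2)∕2`), **`chebyshevU_nodes_sq_sum`** (`= (m+1)∕2`), **`chebyshev_nodes_prod`**,
  **`chebyshevU_nodes_prod`**.
CAVEATS.  Nodes in the chapter's increasing order (`Fin.rev`); the first-kind square sum needs at least two nodes (one node gives `0`, not `1∕2`).  Nothing Ext-side.  New names only.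
-/

open Module Polynomial Real
open scoped Matrix Polynomial

namespace Summit.Ventures.HSemireg.Wedge.HankelOuter

/-! ## §1206. Newton sums and products of the Gauss–Chebyshev nodes -/

/-- **`Σ_k cos((2k'+1)π∕(2(t+1))) = 0`** (trace of the first-kind Chebyshev Jacobi matrix). [Chihara I (4.13); this file, §1206] -/
theorem chebyshev_nodes_sum (t : ℕ) : ∑ k : Fin (t + 1), cos ((2 * ((Fin.rev k : Fin (t + 1)) : ℝ) + 1) * π / (2 * ((t : ℝ) + 1))) = 0 := by
  set bT : ℕ → ℝ := fun j => if j = 1 then 1 / 2 else 1 / 4 with hbT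
  obtain ⟨q, hq0, hq1, hrec⟩ := recurrence_of_coefficients (fun _ => (0 : ℝ)) bT
  have hxq := chebyshev_recurrence_eq_prod (q := q) (a := fun _ => (0 : ℝ)) (b := bT) hq0 hq1 hrec (fun _ => rfl) (if_pos rfl) (fun n => if_neg (by omega)) t
  rw [sum_recurrence_zeros (q := q) (a := fun _ => (0 : ℝ)) (b := bT) hq0 hq1 hrec hxq, Finset.sum_const_zero]

/-- **`Σ_j cos((j'+1)π∕(t+2)) = 0`** (trace of the second-kind Chebyshev Jacobi matrix). [Chihara I (4.13); this file, §1206] -/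
theorem chebyshevU_nodes_sum (t : ℕ) : ∑ k : Fin (t + 1), cos ((((Fin.rev k : Fin (t + 1)) : ℝ) + 1) * π / ((t : ℝ) + 2)) = 0 := by
  obtain ⟨q, hq0, hq1, hrec⟩ := recurrence_of_coefficients (fun _ => (0 : ℝ)) (fun _ => (1 / 4 : ℝ))
  have hxq := chebyshevU_recurrence_eq_prod (q := q) (a := fun _ => (0 : ℝ)) (b := fun _ => (1 / 4 : ℝ)) hq0 hq1 hrec (fun _ => rfl) (fun _ => rfl) t
  rw [sum_recurrence_zeros (q := q) (a := fun _ => (0 : ℝ)) (b := fun _ => (1 / 4 : ℝ)) hq0 hq1 hrec hxq, Finset.sum_const_zero]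

/-- **`Σ_{k<m+2} cos²((2k'+1)π∕(2(m+2))) = (m+2)∕2`** (at least two nodes; `tr J² = Σ a_i² + 2Σ b_i`). [Chihara I (4.14); this file, §1206] -/
theorem chebyshev_nodes_sq_sum (m : ℕ) : ∑ k : Fin (m + 2), cos ((2 * ((Fin.rev k : Fin (m + 2)) : ℝ) + 1) * π / (2 * (((m + 1 : ℕ) : ℝ) + 1))) ^ 2 = ((m : ℝ) + 2) / 2 := by
  set bT : ℕ → ℝ := fun j => if j = 1 then 1 / 2 else 1 / 4 with hbT
  have hb1 : bT 1 = 1 / 2 := if_pos rfl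
  have hb2' : ∀ n : ℕ, bT (n + 1 + 1) = 1 / 4 := fun n => if_neg (by omega)
  obtain ⟨q, hq0, hq1, hrec⟩ := recurrence_of_coefficients (fun _ => (0 : ℝ)) bT
  have hxq := chebyshev_recurrence_eq_prod (q := q) (a := fun _ => (0 : ℝ)) (b := bT) hq0 hq1 hrec (fun _ => rfl) hb1 (fun n => if_neg (by omega)) (m + 1)
  rw [sum_recurrence_zeros_sq (q := q) (a := fun _ => (0 : ℝ)) (b := bT) hq0 hq1 hrec hxq]
  simp only [zero_pow two_ne_zero, Finset.sum_const_zero, zero_add]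
  rw [Finset.sum_range_succ']
  simp only [hb2', hb1, Finset.sum_const, Finset.card_range]
  ring

/-- **`Σ_{j≤m+1} cos²((j'+1)π∕(m+3)) = (m+1)∕2`** (`b ≡ 1∕4`). [Chihara I (4.14); this file, §1206] -/
theorem chebyshevU_nodes_sq_sum (m : ℕ) : ∑ k : Fin (m + 2), cos ((((Fin.rev k : Fin (m + 2)) : ℝ) + 1) * π / (((m + 1 : ℕ) : ℝ) + 2)) ^ 2 = ((m : ℝ) + 1) / 2 := by
  obtain ⟨q, hq0, hq1, hrec⟩ := recurrence_of_coefficients (fun _ => (0 : ℝ)) (fun _ => (1 / 4 : ℝ))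
  have hxq := chebyshevU_recurrence_eq_prod (q := q) (a := fun _ => (0 : ℝ)) (b := fun _ => (1 / 4 : ℝ)) hq0 hq1 hrec (fun _ => rfl) (fun _ => rfl) (m + 1)
  rw [sum_recurrence_zeros_sq (q := q) (a := fun _ => (0 : ℝ)) (b := fun _ => (1 / 4 : ℝ)) hq0 hq1 hrec hxq]
  simp only [zero_pow two_ne_zero, Finset.sum_const_zero, zero_add, Finset.sum_const, Finset.card_range]
  ring

/-- **`∏_k cos((2k'+1)π∕(2(t+1))) = (−1)^{t+1} 2^{−t} T_{t+1}(0)`** (determinant of the first-kind Chebyshev Jacobi matrix, up to sign). [Golub–Welsch 1969; Szegő (1.12.3); this file, §1206] -/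
theorem chebyshev_nodes_prod (t : ℕ) :
    ∏ k : Fin (t + 1), cos ((2 * ((Fin.rev k : Fin (t + 1)) : ℝ) + 1) * π / (2 * ((t : ℝ) + 1))) = (-1) ^ (t + 1) * (1 / 2) ^ t * (Polynomial.Chebyshev.T ℝ ((t : ℤ) + 1)).eval 0 := by
  set bT : ℕ → ℝ := fun j => if j = 1 then 1 / 2 else 1 / 4 with hbT
  obtain ⟨q, hq0, hq1, hrec⟩ := recurrence_of_coefficients (fun _ => (0 : ℝ)) bT
  have hxq := chebyshev_recurrence_eq_prod (q := q) (a := fun _ => (0 : ℝ)) (b := bT) hq0 hq1 hrec (fun _ => rfl) (if_pos rfl) (fun n => if_neg (by omega)) t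
  have hT := chebyshev_recurrence_eq_T (q := q) (a := fun _ => (0 : ℝ)) (b := bT) hq0 hq1 hrec (fun _ => rfl) (if_pos rfl) (fun n => if_neg (by omega)) t
  have h := congrArg (Polynomial.eval 0) (hxq.symm.trans hT)
  rw [eval_prod, eval_mul, eval_C] at h
  simp only [eval_sub, eval_X, eval_C, zero_sub] at h
  rw [Finset.prod_neg, Finset.card_univ, Fintype.card_fin] at h
  have hone : ((-1 : ℝ) ^ (t + 1)) * (-1) ^ (t + 1) = 1 := by rw [← pow_add, Even.neg_one_pow ⟨t + 1, rfl⟩]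
  calc ∏ k : Fin (t + 1), cos ((2 * ((Fin.rev k : Fin (t + 1)) : ℝ) + 1) * π / (2 * ((t : ℝ) + 1)))
        = ((-1 : ℝ) ^ (t + 1) * (-1) ^ (t + 1)) * ∏ k : Fin (t + 1), cos ((2 * ((Fin.rev k : Fin (t + 1)) : ℝ) + 1) * π / (2 * ((t : ℝ) + 1))) := by rw [hone, one_mul]
    _ = (-1) ^ (t + 1) * ((1 / 2 : ℝ) ^ t * (Polynomial.Chebyshev.T ℝ ((t : ℤ) + 1)).eval 0) := by rw [mul_assoc, h]
    _ = (-1) ^ (t + 1) * (1 / 2) ^ t * (Polynomial.Chebyshev.T ℝ ((t : ℤ) + 1)).eval 0 := by ring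

/-- **`∏_j cos((j'+1)π∕(t+2)) = (−1)^{t+1} 2^{−(t+1)} U_{t+1}(0)`** (determinant of the second-kind Chebyshev Jacobi matrix, up to sign). [Golub–Welsch 1969; Szegő (1.12.3); this file, §1206] -/
theorem chebyshevU_nodes_prod (t : ℕ) :
    ∏ k : Fin (t + 1), cos ((((Fin.rev k : Fin (t + 1)) : ℝ) + 1) * π / ((t : ℝ) + 2)) = (-1) ^ (t + 1) * (1 / 2) ^ (t + 1) * (Polynomial.Chebyshev.U ℝ (((t + 1 : ℕ) : ℤ))).eval 0 := by
  obtain ⟨q, hq0, hq1, hrec⟩ := recurrence_of_coefficients (fun _ => (0 : ℝ)) (fun _ => (1 / 4 : ℝ))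
  have hxq := chebyshevU_recurrence_eq_prod (q := q) (a := fun _ => (0 : ℝ)) (b := fun _ => (1 / 4 : ℝ)) hq0 hq1 hrec (fun _ => rfl) (fun _ => rfl) t
  have hU := chebyshevU_recurrence_eq_U (q := q) (a := fun _ => (0 : ℝ)) (b := fun _ => (1 / 4 : ℝ)) hq0 hq1 hrec (fun _ => rfl) (fun _ => rfl) (t + 1)
  have h := congrArg (Polynomial.eval 0) (hxq.symm.trans hU)
  rw [eval_prod, eval_mul, eval_C] at h
  simp only [eval_sub, eval_X, eval_C, zero_sub] at h
  rw [Finset.prod_neg, Finset.card_univ, Fintype.card_fin] at h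
  have hone : ((-1 : ℝ) ^ (t + 1)) * (-1) ^ (t + 1) = 1 := by rw [← pow_add, Even.neg_one_pow ⟨t + 1, rfl⟩]
  calc ∏ k : Fin (t + 1), cos ((((Fin.rev k : Fin (t + 1)) : ℝ) + 1) * π / ((t : ℝ) + 2))
        = ((-1 : ℝ) ^ (t + 1) * (-1) ^ (t + 1)) * ∏ k : Fin (t + 1), cos ((((Fin.rev k : Fin (t + 1)) : ℝ) + 1) * π / ((t : ℝ) + 2)) := by rw [hone, one_mul]
    _ = (-1) ^ (t + 1) * ((1 / 2 : ℝ) ^ (t + 1) * (Polynomial.Chebyshev.U ℝ (((t + 1 : ℕ) : ℤ))).eval 0) := by rw [mul_assoc, h]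
    _ = (-1) ^ (t + 1) * (1 / 2) ^ (t + 1) * (Polynomial.Chebyshev.U ℝ (((t + 1 : ℕ) : ℤ))).eval 0 := by ring

end Summit.Ventures.HSemireg.Wedge.HankelOuter
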